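import Summits.Ventures.LatticeQCDFlow.Exactness.ReversiblePoincareCeiling
import HarnessLib

/-!
# The Poincaré ceiling WITHOUT a summability hypothesis for samplers with nonnegative autocovariances

HONEST FRAMING: exact (Metropolis-corrected) sampling algorithms for lattice gauge theory;
figures of merit are autocorrelation/cost numbers at stated couplings and volumes; no
continuum-physics claim.  (SCALAR calibration rung S0-A: not a gauge result.)

Venture `LatticeQCDFlow` (cell pub-lqcd), topic `Exactness`; FANOUT row 2 (`s0-phi4`).  NEW WORK
of the cell over `Exactness/ReversiblePoincareCeiling.lean` (Poincaré constant `γ` on the admissible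
class ⇒ `Σ_k C(k) sᵏ ≤ P/(1 − s(1 − γ))` unconditionally, and `τ_int ≤ 1/γ − ½` under summability).
Nothing is cited as a fact; elementary real analysis only.  For a sampler whose autocovariances are
NONNEGATIVE (a positive operator — the exact flow sampler `imhOp` is one, `autocov_nonneg` in the
tree's flow files; so is any two-step update `K = T²` with `T` reversible), bounded Abel sums of the
nonnegative series force its summability, so the `τ_int` ceiling holds with no a-priori summability.

## What is proved (namespace `RevOp`)

* **`summable_of_nonneg_of_abelSum_le`** — `0 ≤ C(k)`, `Σ_k C(k) sᵏ ≤ B` for all `0 ≤ s < 1`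
  ⇒ `C` summable and `Σ_k C(k) ≤ B` (partial sums are limits `s ↑ 1` of bounded polynomials);
* **`tauInt_le_of_poincare_of_nonneg`** — `RevOp` format, `1 ∈ A`, `K 1 = 1`, `Z > 0`, Poincaré
  with `γ > 0` on centred observables, `g ∈ A` centred with `C_g(0) > 0` and `C_g(k) ≥ 0`:
  the normalised series IS summable and **`τ_int(g) ≤ 1/γ − ½`**.

NOT CLAIMED: nonnegativity of autocovariances for the local or HMC arms (false in general); any
number for any run.
-/

namespace Summit.Ventures.LatticeQCDFlow.Exactness

open Real MeasureTheory Filter Finset Topology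
open Summit.Ventures.LatticeQCDFlow.Scoring

namespace RevOp

variable {X : Type*} [MeasurableSpace X] {μ : Measure X} {w : X → ℝ} {A : (X → ℝ) → Prop}
  {K : (X → ℝ) → (X → ℝ)}

/-! ## Positive autocovariances: no summability hypothesis needed -/

/-- **Bounded Abel sums of a NONNEGATIVE sequence force summability**: if `0 ≤ C(k)` for all `k` and
`Σ_k C(k) sᵏ ≤ B` for every `0 ≤ s < 1`, then `C` is summable and `Σ_k C(k) ≤ B`. -/
theorem summable_of_nonneg_of_abelSum_le {C : ℕ → ℝ} (hC : ∀ k, 0 ≤ C k) {B : ℝ}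
    (hsum : ∀ s : ℝ, 0 ≤ s → s < 1 → Summable fun k => C k * s ^ k)
    (hB : ∀ s : ℝ, 0 ≤ s → s < 1 → ∑' k, C k * s ^ k ≤ B) :
    Summable C ∧ ∑' k, C k ≤ B := by
  -- every partial sum is `≤ B`: `Σ_{k<N} C(k) sᵏ ≤ B` for all `s < 1`, and let `s ↑ 1`
  have hpart : ∀ N : ℕ, ∑ k ∈ Finset.range N, C k ≤ B := by
    intro N
    have hcont : Continuous fun s : ℝ => ∑ k ∈ Finset.range N, C k * s ^ k :=
      continuous_finsetSum _ fun k _ => continuous_const.mul (continuous_pow k)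
    have hlim : Tendsto (fun s : ℝ => ∑ k ∈ Finset.range N, C k * s ^ k) (𝓝[<] 1)
        (𝓝 (∑ k ∈ Finset.range N, C k)) := by
      have h1 : Tendsto (fun s : ℝ => ∑ k ∈ Finset.range N, C k * s ^ k) (𝓝[<] 1)
          (𝓝 (∑ k ∈ Finset.range N, C k * (1 : ℝ) ^ k)) :=
        (hcont.tendsto 1).mono_left nhdsWithin_le_nhds
      simpa using h1
    refine le_of_tendsto hlim ?_
    filter_upwards [Ioo_mem_nhdsLT (show (0 : ℝ) < 1 by norm_num)] with s hs
    exact (Summable.sum_le_tsum _ (fun k _ => mul_nonneg (hC k) (pow_nonneg hs.1.le k))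
      (hsum s hs.1.le hs.2)).trans (hB s hs.1.le hs.2)
  have hS : Summable C := summable_of_sum_range_le hC hpart
  exact ⟨hS, tsum_le_of_sum_range_le hC hpart⟩

/-- **THE POINCARÉ CEILING WITHOUT A SUMMABILITY HYPOTHESIS, for samplers with nonnegative
autocovariances** (positive operators: the flow sampler, any two-step `K = T²`).  `1 ∈ A`,
`K 1 = 1`, `Z > 0`, Poincaré with `γ > 0` on centred observables; `g ∈ A` centred with `C_g(0) > 0`
and `C_g(k) ≥ 0` for all `k`.  Then the normalised series IS summable and `τ_int(g) ≤ 1/γ − ½`. -/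
theorem tauInt_le_of_poincare_of_nonneg (hw0 : ∀ x, 0 ≤ w x) (hA1 : A (fun _ => (1 : ℝ)))
    (hAi : ∀ ⦃f h : X → ℝ⦄, A f → A h → Integrable (fun x => f x * h x * w x) μ)
    (hAc : ∀ ⦃f h : X → ℝ⦄ (c : ℝ), A f → A h → A (fun x => f x + c * h x))
    (hAK : ∀ ⦃f : X → ℝ⦄, A f → A (K f))
    (hlin : ∀ ⦃f h : X → ℝ⦄ (c : ℝ), A f → A h →
      ∀ x, K (fun s => f s + c * h s) x = K f x + c * K h x)
    (hsymm : ∀ ⦃f h : X → ℝ⦄, A f → A h →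
      ∫ x, K f x * h x * w x ∂μ = ∫ x, f x * K h x * w x ∂μ)
    (hcontr : ∀ ⦃f : X → ℝ⦄, A f → ∫ x, K f x ^ 2 * w x ∂μ ≤ ∫ x, f x ^ 2 * w x ∂μ)
    (hunit : ∀ x, K (fun _ => (1 : ℝ)) x = 1) (hZ : 0 < ∫ x, w x ∂μ)
    {γ : ℝ} (hγ : 0 < γ)
    (hPoinc : ∀ ⦃u : X → ℝ⦄, A u → ∫ x, u x * w x ∂μ = 0 →
      γ * ∫ x, u x ^ 2 * w x ∂μ ≤ (∫ x, u x ^ 2 * w x ∂μ) - ∫ x, u x * K u x * w x ∂μ)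
    {g : X → ℝ} (hg : A g) (hg0 : ∫ x, g x * w x ∂μ = 0) (hP : 0 < ∫ x, g x ^ 2 * w x ∂μ)
    (hpos : ∀ k, 0 ≤ ∫ x, g x * (K^[k] g) x * w x ∂μ) :
    (Summable fun n => (∫ x, g x * (K^[n + 1] g) x * w x ∂μ) / ∫ x, g x ^ 2 * w x ∂μ) ∧
    tauInt (fun n => (∫ x, g x * (K^[n] g) x * w x ∂μ) / ∫ x, g x ^ 2 * w x ∂μ) ≤ 1 / γ - 1 / 2 := by
  set C : ℕ → ℝ := fun k => ∫ x, g x * (K^[k] g) x * w x ∂μ with hC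
  set P := ∫ x, g x ^ 2 * w x ∂μ with hPdef
  -- uniform Abel bound `Σ C(k) sᵏ ≤ P / min(γ, 1)`-type: use `P/(1 − s(1−γ)) ≤ P · max(1, 1/γ)`
  have hB : ∀ s : ℝ, 0 ≤ s → s < 1 → ∑' k, C k * s ^ k ≤ P * max 1 (1 / γ) := by
    intro s hs0 hs1
    have h := abelSum_le_of_poincare hw0 hA1 hAi hAc hAK hlin hsymm hcontr hunit hZ hγ.le hPoinc hg
      hg0 hs0 hs1
    refine h.trans ?_
    have hden : 0 < 1 - s * (1 - γ) := by nlinarith [mul_nonneg hs0 hγ.le]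
    rw [div_le_iff₀ hden]
    -- `P ≤ P max(1,1/γ) (1 − s(1−γ))`: if `γ ≥ 1` the bracket is `≥ 1`; else `≥ γ` and `max ≥ 1/γ`
    rcases le_or_gt 1 γ with hγ1 | hγ1
    · have h1 : 1 ≤ 1 - s * (1 - γ) := by nlinarith
      calc P = P * 1 * 1 := by ring
        _ ≤ P * max 1 (1 / γ) * (1 - s * (1 - γ)) :=
            mul_le_mul (mul_le_mul_of_nonneg_left (le_max_left _ _) hP.le) h1 zero_le_one
              (mul_nonneg hP.le (zero_le_one.trans (le_max_left _ _)))
    · have h1 : γ ≤ 1 - s * (1 - γ) := by nlinarith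
      calc P = P * (1 / γ) * γ := by field_simp
        _ ≤ P * max 1 (1 / γ) * (1 - s * (1 - γ)) :=
            mul_le_mul (mul_le_mul_of_nonneg_left (le_max_right _ _) hP.le) h1 hγ.le
              (mul_nonneg hP.le (zero_le_one.trans (le_max_left _ _)))
  have hsum : ∀ s : ℝ, 0 ≤ s → s < 1 → Summable fun k => C k * s ^ k :=
    fun s hs0 hs1 => summable_autocov_mul_pow hw0 hAi hAK hcontr hg hs0 hs1
  obtain ⟨hS, -⟩ := summable_of_nonneg_of_abelSum_le hpos hsum hB
  have hs : Summable fun n => C (n + 1) / P :=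
    ((summable_nat_add_iff 1).2 hS).div_const P
  exact ⟨hs, tauInt_le_of_poincare hw0 hA1 hAi hAc hAK hlin hsymm hunit hZ hγ hPoinc hg hg0 hP hs⟩

end RevOp

end Summit.Ventures.LatticeQCDFlow.Exactness
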